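import Mathlib.Combinatorics.SetFamily.Compression.Down
import Mathlib.Tactic
import HarnessLib
import HarnessLib.Audit.Tags
import Summits.CriticalPhenomena.PercolationContinuityZ3.Theorems.PercNearOneGluingNoHeavyLowerTailSahiPartitionDaykinCredit

/-!
# The strict rainbow lemma, I: definitions and typed statements

Support file (seat `prim-masterthm-p1`, gen 40; `--supports stmt-CriticalPhenomena-4575`).  THIS FILE: the definitions (`posRainbow`,
`RainbowDegenerate`), the inductive-hypothesis predicate `RainbowStrictOn`, and the typed statements `RainbowStrict`, `PinnedResidual`; the theorems
are in `…SahiRainbowStrictCompress` (compression lemmas) and `…SahiRainbowStrict` (the two compression theorems and the reduction).  No `sorry`,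
standard axioms.  Memo `run/shared/lean/prim/prim-masterthm/FROM-prim-masterthm-p1-g40-STRICT-RAINBOW.md`.

SETTING (`…SahiPartitionDaykin`, `…SahiPartitionDaykinCredit`): `𝒜 ⊆ 2^F` complement-free, `rainbowMeets F 𝒜 = {∅} ∪ {a ∩ b, F \ (a ∪ b) : a ≠ b}`;
the RAINBOW LEMMA `RainbowMeetCojoin` (OPEN) asks `#𝒜 ≤ #rainbowMeets F 𝒜`.  Gen 33 proved the CREDIT LEMMA for compression at a point `r`
(`card_rainbowMeets_compress`: with `𝔅 = 𝒜.memberSubfamily r ∪ 𝒜.nonMemberSubfamily r` the projections and `𝔄 = 𝒜.memberSubfamily r ∩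
𝒜.nonMemberSubfamily r` the doubled members, `#rainbowMeets (F.erase r) 𝔅 + #posRainbow (F.erase r) 𝔄 ≤ #rainbowMeets F 𝒜`) and identified the
two kinds of BAD points blocking the induction: (α) `𝔅` not complement-free (a NEAR-COMPLEMENTARY pair at `r`: two members `a, b` with `a ∩ b ⊆ {r}`,
`F.erase r ⊆ a ∪ b`), and (β) `𝔄 ≠ ∅` pairwise intersecting and non-covering with `{r}` not a colour (then `#posRainbow 𝔄` may be `#𝔄 − 1`).

NEW HERE ([this work], gen 40).  Call `𝒜` DEGENERATE if two distinct members are disjoint or cover `F` (equivalently `∅ ∈ posRainbow F 𝒜`).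
STRENGTHENED STATEMENT `RainbowStrictOn F`: every complement-free `𝒞 ⊆ 2^F` has `#𝒞 ≤ #rainbowMeets F 𝒞`, and `#𝒞 + 1 ≤ #rainbowMeets F 𝒞` if
`𝒞` is NON-degenerate with `#𝒞 ≥ 2`.  EVIDENCE: true for every complement-free family of `2^n`, `n ≤ 5` (43 046 688 families of `2^5`; engines
`prim-masterthm-p1/code-g40/c/rbplus.c`) and for `1.47·10⁶` random complement-free families of `2^6` (`step6.c`), 0 failures; the 260 tight
families of `2^5` are all degenerate.  With the strict form as inductive hypothesis, bad points of type (β) DISAPPEAR: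
* `card_add_one_le_card_rainbowMeets_of_not_degenerate` — if `RainbowStrictOn (F.erase r)` holds for SOME `r ∈ F`, then every non-degenerate
  complement-free `𝒜 ⊆ 2^F` with `#𝒜 ≥ 2` has `#𝒜 + 1 ≤ #rainbowMeets F 𝒜` (for non-degenerate `𝒜`, `𝔅` is automatically complement-free, `𝔄` is
  non-degenerate so the hypothesis repays the doubled members in full, a third member supplies a non-empty twin colour, and a degenerate `𝔅`
  supplies the twin `∅`/`{r}`): the strict form PROPAGATES through compression at ANY point;
* `card_le_card_rainbowMeets_of_unpinned` — if `RainbowStrictOn (F.erase r)` and `𝔅` is complement-free (no near-complementary pair at `r`), then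
  `#𝒜 ≤ #rainbowMeets F 𝒜`, with no condition on the doubled members;
* `rainbowStrictOn_of_residual`, `rainbowMeetCojoin_of_residual` — consequently the rainbow lemma AND its strict form for all families follow from
  the weak inequality for the RESIDUAL class: degenerate complement-free families that are FULLY PINNED (a near-complementary pair at EVERY point of
  `F`), given the statement on all smaller ground sets.  For such families every singleton is a colour (`singleton_mem_rainbowMeets_of_pinned`).
  CENSUS of the residual (`frpin.c`, adding "every member redundant", which member deletion also allows): none on `2^≤2`; on `2^3` exactly the two
  tight quadruples `{∅,01,02,12}`, `{F,0,1,2}`; on `2^4` 16 families (N = 8, slack 3); on `2^5` 4 370 families, minimum slack 3; and the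
  compression count closes with the full bookkeeping (all extra colours and twins) at EVERY point of EVERY complement-free family of `2^≤5` and of
  all sampled families of `2^6` (`step.c`, `step2.c`, `step6.c`).
HONEST FRAMING: `RainbowMeetCojoin` and `RainbowStrict` remain OPEN; the theorems are unconditional reductions. [this work]
-/

namespace Summit.CriticalPhenomena.PercolationContinuityZ3.Theorems.SahiColouredDaykin

open Finset

variable {α : Type*} [DecidableEq α]

/-! ### 1. Positive rainbow meets, degeneracy, the strict statement -/

/-- The POSITIVE rainbow meets: meets and complemented joins of distinct members (the base colour `∅` not adjoined). [this work] -/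
def posRainbow (F : Finset α) (𝒜 : Finset (Finset α)) : Finset (Finset α) :=
  (𝒜.offDiag.image fun p => p.1 ∩ p.2) ∪ (𝒜.offDiag.image fun p => F \ (p.1 ∪ p.2))

/-- `rainbowMeets` is `posRainbow` with `∅` adjoined (definitional). [this work] -/
theorem rainbowMeets_eq_insert_posRainbow (F : Finset α) (𝒜 : Finset (Finset α)) :
    rainbowMeets F 𝒜 = insert ∅ (posRainbow F 𝒜) := rfl

/-- Unpacking membership in `posRainbow`. [this work] -/
theorem mem_posRainbow_iff {F : Finset α} {𝒜 : Finset (Finset α)} {Z : Finset α} :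
    Z ∈ posRainbow F 𝒜 ↔ ∃ a ∈ 𝒜, ∃ b ∈ 𝒜, a ≠ b ∧ (Z = a ∩ b ∨ Z = F \ (a ∪ b)) := by
  unfold posRainbow
  simp only [mem_union, mem_image, mem_offDiag, Prod.exists]
  constructor
  · rintro (⟨a, b, ⟨ha, hb, hab⟩, rfl⟩ | ⟨a, b, ⟨ha, hb, hab⟩, rfl⟩)
    · exact ⟨a, ha, b, hb, hab, Or.inl rfl⟩
    · exact ⟨a, ha, b, hb, hab, Or.inr rfl⟩
  · rintro ⟨a, ha, b, hb, hab, rfl | rfl⟩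
    · exact Or.inl ⟨a, b, ⟨ha, hb, hab⟩, rfl⟩
    · exact Or.inr ⟨a, b, ⟨ha, hb, hab⟩, rfl⟩

/-- A family is DEGENERATE (in `F`) if two distinct members are disjoint or cover `F`, i.e. `∅` is a positive rainbow meet. [this work] -/
def RainbowDegenerate (F : Finset α) (𝒜 : Finset (Finset α)) : Prop := (∅ : Finset α) ∈ posRainbow F 𝒜

/-- Unpacking `RainbowDegenerate`. [this work] -/
theorem degenerate_iff {F : Finset α} {𝒜 : Finset (Finset α)} :
    RainbowDegenerate F 𝒜 ↔ ∃ a ∈ 𝒜, ∃ b ∈ 𝒜, a ≠ b ∧ (a ∩ b = ∅ ∨ F \ (a ∪ b) = ∅) := by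
  unfold RainbowDegenerate
  rw [mem_posRainbow_iff]
  constructor
  · rintro ⟨a, ha, b, hb, hab, h | h⟩
    · exact ⟨a, ha, b, hb, hab, Or.inl h.symm⟩
    · exact ⟨a, ha, b, hb, hab, Or.inr h.symm⟩
  · rintro ⟨a, ha, b, hb, hab, h | h⟩
    · exact ⟨a, ha, b, hb, hab, Or.inl h.symm⟩
    · exact ⟨a, ha, b, hb, hab, Or.inr h.symm⟩

/-- A disjoint pair of distinct members makes the family degenerate. [this work] -/
theorem degenerate_of_inter_eq_empty {F : Finset α} {𝒜 : Finset (Finset α)} {a b : Finset α} (ha : a ∈ 𝒜) (hb : b ∈ 𝒜) (hab : a ≠ b)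
    (h : a ∩ b = ∅) : RainbowDegenerate F 𝒜 :=
  degenerate_iff.2 ⟨a, ha, b, hb, hab, Or.inl h⟩

/-- A covering pair of distinct members makes the family degenerate. [this work] -/
theorem degenerate_of_sdiff_union_eq_empty {F : Finset α} {𝒜 : Finset (Finset α)} {a b : Finset α} (ha : a ∈ 𝒜) (hb : b ∈ 𝒜)
    (hab : a ≠ b) (h : F \ (a ∪ b) = ∅) : RainbowDegenerate F 𝒜 :=
  degenerate_iff.2 ⟨a, ha, b, hb, hab, Or.inr h⟩

/-- For a non-degenerate family the colours are the positive colours plus `∅`. [this work] -/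
theorem card_rainbowMeets_of_not_degenerate {F : Finset α} {𝒜 : Finset (Finset α)} (h : ¬ RainbowDegenerate F 𝒜) :
    #(rainbowMeets F 𝒜) = #(posRainbow F 𝒜) + 1 := by
  rw [rainbowMeets_eq_insert_posRainbow, card_insert_of_notMem h]

/-- For a degenerate family `∅` is already a positive colour. [this work] -/
theorem card_rainbowMeets_of_degenerate {F : Finset α} {𝒜 : Finset (Finset α)} (h : RainbowDegenerate F 𝒜) :
    #(rainbowMeets F 𝒜) = #(posRainbow F 𝒜) := by
  rw [rainbowMeets_eq_insert_posRainbow, insert_eq_of_mem h]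

/-- **The strengthened rainbow statement on the ground set `F`** (the inductive hypothesis of this file): every complement-free `𝒞 ⊆ 2^F`
has at least `#𝒞` rainbow meets, and at least `#𝒞 + 1` if it is non-degenerate with at least two members. [this work] -/
def RainbowStrictOn (F : Finset α) : Prop :=
  ∀ 𝒞 : Finset (Finset α), (∀ c ∈ 𝒞, c ⊆ F) → (∀ c ∈ 𝒞, F \ c ∉ 𝒞) →
    #𝒞 ≤ #(rainbowMeets F 𝒞) ∧ (2 ≤ #𝒞 → ¬ RainbowDegenerate F 𝒞 → #𝒞 + 1 ≤ #(rainbowMeets F 𝒞))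

/-- **CONJECTURE (the strict rainbow lemma; typed).**  For every finite ground set the strengthened statement `RainbowStrictOn` holds: a
complement-free family of `N ≥ 2` sets no two of which are disjoint or cover `F` has at least `N + 1` rainbow meets (and every complement-free
family has at least `N`).  Exhaustively true on `2^n`, `n ≤ 5`, and on `1.47·10⁶` random complement-free families of `2^6` (file header); implies
`RainbowMeetCojoin`; reduced below to the fully pinned degenerate residual. [this work] [status: open] -/
@[conjecture] def RainbowStrict (α : Type*) [DecidableEq α] : Prop := ∀ F : Finset α, RainbowStrictOn F

/-- The strict rainbow lemma implies the rainbow lemma. [this work] -/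
theorem rainbowMeetCojoin_of_rainbowStrict (h : RainbowStrict α) : RainbowMeetCojoin α :=
  fun F P hPF hcf => (h F P hPF hcf).1

/-! ### 2. The residual statement -/

/-- **The residual statement (typed).**  Every DEGENERATE complement-free family `𝒜 ⊆ 2^F` that is FULLY PINNED (at every `r ∈ F` some two
members `a, b` have `a ∩ b ⊆ {r}` and `F.erase r ⊆ a ∪ b`, i.e. the projected family at `r` is not complement-free) satisfies the rainbow
inequality `#𝒜 ≤ #rainbowMeets F 𝒜`, granted the strengthened statement on every `F.erase r`.  By `rainbowStrict_of_pinnedResidual` this is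
ALL that is missing for `RainbowMeetCojoin` (and `RainbowStrict`).  Census (`prim-masterthm-p1/code-g40/c/frpin.c`, with the additional
reduction "every member redundant"): on `2^3` the residual consists of the two tight quadruples, on `2^4` of 16 families (N = 8, slack 3),
on `2^5` of 4 370 families (slack ≥ 3). [this work] [status: open] -/
@[conjecture] def PinnedResidual (α : Type*) [DecidableEq α] : Prop :=
  ∀ (F : Finset α) (𝒜 : Finset (Finset α)), (∀ a ∈ 𝒜, a ⊆ F) → (∀ a ∈ 𝒜, F \ a ∉ 𝒜) → RainbowDegenerate F 𝒜 →
    (∀ r ∈ F, ¬ ∀ b ∈ 𝒜.memberSubfamily r ∪ 𝒜.nonMemberSubfamily r,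
      (F.erase r) \ b ∉ 𝒜.memberSubfamily r ∪ 𝒜.nonMemberSubfamily r) →
    (∀ r ∈ F, RainbowStrictOn (F.erase r)) → #𝒜 ≤ #(rainbowMeets F 𝒜)

end Summit.CriticalPhenomena.PercolationContinuityZ3.Theorems.SahiColouredDaykin
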